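import Literature.IUT.HodgeArakelov.CohomologyLimitKummerComap

/-!
# Pull-back of the cohomology limit `lim_K H¹(H|_K, A)` along `ι : Π₀ → Π` INTO A PRESCRIBED coefficient system
# `φ₀ : Π₀ → G'` that induces THE SAME ACTION on `A` as `φ ∘ ι` — the faithful junction for the labelled copies
# `Ψ_cns(M^Θ_*)_t` of [IUTchII] Cor 3.5 (i)/(ii) (repair of GAP-LEDGER G-w4d004-1; definitions + laws)

S. Mochizuki, *Inter-universal Teichmüller theory II*, kurims manuscript (Dec. 2020), Cor. 3.5 (i)/(ii) pp. 94–95: the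
restrictions to the decomposition groups `D^δ_{t,μ_-}` of the various labels `t` land in copies
"`lim_{J_G} H¹(G_v(…)_t|_{J_G}, Π_μ(…))`" compared through "the inclusions `G_v(M^Θ_*) ↪ Π_{v▶}(M^Θ_*▶)` determined by the
various choices of the `D^δ_{t,μ_-}`" and the `F_l^⋊±`-symmetrizing isomorphisms [cite: Mochizuki2012, Cor 3.5 (ii) p.95].
abc-iut cell, layer L6, seat abc-iut-w4-d004 gen 4; nodes IUTchII:Cor3.5(ii) / Cor3.6(ii); GAP-LEDGER **G-w4d004-1**.

WHY (finding F-w4d004-g4-1 of this seat). The family-level capstones of the Cor 3.5 (ii) / Cor 3.6 (ii) rows identified the labelled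
targets through abc-iut-w4-d004 gen 2's `h1LimCongr (h : φ₁ = φ₂)` (`CohomologyLimitCongr.lean`), i.e. under the hypothesis
`hφ : ∀ t, φ ∘ s_t = φ₀` — EQUALITY OF COEFFICIENT HOMOMORPHISMS `G_v → (Π^tp_X)^Θ`. For evaluation sections `s_t`, `s_{t'}` of
DIFFERENT labels this equality fails (their images in the theta quotient are decomposition groups of different points), although
the induced conjugation ACTIONS on the cyclotome `l·Δ_Θ` coincide (`Ker ε` acts trivially — abc-iut-w4-d043's
`aug_ker_acts_trivially`; `Δ_Θ` is central in `Δ^Θ_X`). Print only uses the latter. HERE the pull-back along `ι` is built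
DIRECTLY INTO the `φ₀`-system under equality of actions, so that no hom-level identification is needed:
* `contH1ComapActCocycle` / `contH1ComapAct φ A ι hι φ₀ hact h : H¹_φ(H, A) → H¹_{φ₀}(H₀, A)` (fixed level; `hact : ∀ g a,
  φ(ι g)·a·φ(ι g)⁻¹ = φ₀(g)·a·φ₀(g)⁻¹`), with `contH1ComapAct_mk`, `contH1Res_comapAct`, `contH1ComapAct_conj` (intertwines
  the conjugation actions) and `comapAct_kummerContClass` (carries Kummer classes to Kummer classes);
* `gmodComapAct`, **`h1LimComapAct φ A ι hι φ₀ hact hH : lim_K H¹_φ(H ⊓ K, A) → lim_{K₀} H¹_{φ₀}(H₀ ⊓ K₀, A)`** (by the universal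
  property, member at `K` ↦ member at `ι⁻¹K`), `h1LimComapAct_of`, **`h1LimComapAct_conj`** (`ι^*(conj_{ι σ} y) = conj_σ(ι^* y)`),
  **`h1LimComapAct_h1LimKummer(On)`** (naturality of abc-iut-w4-d007's limit Kummer map: `ι^*(κ_Π b) = κ_{Π₀}(b)` for ANY coefficient
  datum `c₀` over `φ₀` with the same underlying `Λ(A) → A'`).
With `φ₀ := φ ∘ ι` and `hact := rfl` these are abc-iut-w4-d004 gen 2's `h1LimComap…` (not restated: the new maps are the
generalisation, the old ones stay). Elementary functoriality of `H¹` in the pair (group homomorphism, compatible coefficient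
action) [cite: NeukirchSchmidtWingberg2008, I §5]; constructions over Mathlib + the landed files; nothing of [IUTchII] is asserted
(claim key `Mochizuki2012` disputed, D-0012); no side taken on [IUTchIII] Cor 3.12.
-/

noncomputable section

/-! ### 1. Fixed level: `H¹_φ(H, A) → H¹_{φ₀}(H₀, A)` along `ι` under equality of actions -/

namespace Literature.IUT.HodgeArakelov

open Literature.AnabelianGeometry.EtaleTheta CohomologySystemOfContH1

section FixedLevel

variable {G₀ G G' : Type*} [Group G₀] [TopologicalSpace G₀] [Group G] [TopologicalSpace G]
  [Group G'] [TopologicalSpace G'] [IsTopologicalGroup G']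
  (φ : G →* G') (A : Subgroup G') [A.Normal] [IsMulCommutative A]
  (ι : G₀ →* G) (hι : Continuous ι) (φ₀ : G₀ →* G')
  (hact : ∀ (g : G₀) (a : A), MulAut.conjNormal (φ (ι g)) a = MulAut.conjNormal (φ₀ g) a)

/-- Pull-back of cocycles along `ι : G₀ → G` from `H ≤ G` to `H₀ ≤ G₀` (`ι(H₀) ≤ H`) INTO the coefficient system of a
homomorphism `φ₀ : G₀ → G'` inducing the same conjugation action on `A` as `φ ∘ ι` (the cocycle condition transports
along `hact`). [cite: NeukirchSchmidtWingberg2008, I §2 and II §7] -/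
def contH1ComapActCocycle {H₀ : Subgroup G₀} {H : Subgroup G} (h : H₀.map ι ≤ H) :
    contCocycles φ A H →* contCocycles φ₀ A H₀ where
  toFun f := ⟨fun x => f.1 ⟨ι x.1, h ⟨x.1, x.2, rfl⟩⟩,
    f.2.1.comp ((hι.comp continuous_subtype_val).subtype_mk _),
    fun g g' => by
      have := f.2.2 ⟨ι g.1, h ⟨g.1, g.2, rfl⟩⟩ ⟨ι g'.1, h ⟨g'.1, g'.2, rfl⟩⟩
      rw [← hact]
      simpa only [Subgroup.coe_mul, map_mul, MulMemClass.mk_mul_mk] using this⟩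
  map_one' := rfl
  map_mul' _ _ := rfl

/-- **Pull-back `H¹_φ(H, A) → H¹_{φ₀}(H₀, A)` along `ι` into a prescribed coefficient system with the same action**
(coboundaries go to coboundaries by `hact`). [cite: NeukirchSchmidtWingberg2008, I §2 and II §7] -/
def contH1ComapAct {H₀ : Subgroup G₀} {H : Subgroup G} (h : H₀.map ι ≤ H) :
    ContH1 φ A H →* ContH1 φ₀ A H₀ :=
  QuotientGroup.map _ _ (contH1ComapActCocycle φ A ι hι φ₀ hact h) (by
    intro f hf
    obtain ⟨a, ha⟩ := (mem_contCoboundaries_iff _).mp (Subgroup.mem_subgroupOf.mp hf)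
    refine Subgroup.mem_subgroupOf.mpr ((mem_contCoboundaries_iff _).mpr ⟨a, ?_⟩)
    funext x
    have := congrFun ha ⟨ι x.1, h ⟨x.1, x.2, rfl⟩⟩
    rw [← hact]
    simpa [contH1ComapActCocycle] using this)

/-- `contH1ComapAct` on the class of a cocycle. [cite: NeukirchSchmidtWingberg2008, I §2 and II §7] -/
theorem contH1ComapAct_mk {H₀ : Subgroup G₀} {H : Subgroup G} (h : H₀.map ι ≤ H) (f : H → A)
    (hf : f ∈ contCocycles φ A H) :
    contH1ComapAct φ A ι hι φ₀ hact h (ContH1.mk f hf) =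
      ContH1.mk (fun x => f ⟨ι x.1, h ⟨x.1, x.2, rfl⟩⟩) (contH1ComapActCocycle φ A ι hι φ₀ hact h ⟨f, hf⟩).2 := rfl

/-- The pull-back commutes with restriction (`H₀' ≤ H₀` over `H' ≤ H`). [cite: NeukirchSchmidtWingberg2008, I §2 and II §7] -/
theorem contH1Res_comapAct {H₀ H₀' : Subgroup G₀} {H H' : Subgroup G} (h : H₀.map ι ≤ H) (h' : H₀'.map ι ≤ H')
    (h₀ : H₀' ≤ H₀) (hH : H' ≤ H) (x : ContH1 φ A H) :
    ContH1.res φ₀ A h₀ (contH1ComapAct φ A ι hι φ₀ hact h x) =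
      contH1ComapAct φ A ι hι φ₀ hact h' (ContH1.res φ A hH x) := by
  induction x using QuotientGroup.induction_on with
  | H f => rfl

/-- **The pull-back intertwines the conjugation actions**: `ι^*(conj_{ι σ} x) = conj_σ (ι^* x)` (`H₀`, `H` normal; the
coefficient twists `φ(ι σ)` and `φ₀ σ` agree on `A` by `hact`). [cite: NeukirchSchmidtWingberg2008, I §2 and II §7] -/
theorem contH1ComapAct_conj [IsTopologicalGroup G₀] [IsTopologicalGroup G] {H₀ : Subgroup G₀} {H : Subgroup G}
    [H₀.Normal] [H.Normal] (h : H₀.map ι ≤ H) (σ : G₀) (x : ContH1 φ A H) :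
    contH1ComapAct φ A ι hι φ₀ hact h (ContH1.conj φ A (ι σ) x) =
      ContH1.conj φ₀ A σ (contH1ComapAct φ A ι hι φ₀ hact h x) := by
  induction x using QuotientGroup.induction_on with
  | H f =>
    apply congrArg (QuotientGroup.mk (s := (contCoboundaries φ₀ A H₀).subgroupOf (contCocycles φ₀ A H₀)))
    apply Subtype.ext
    funext y
    change MulAut.conjNormal (φ (ι σ)) (f.1 (MulAut.conjNormal (ι σ)⁻¹ ⟨ι y.1, _⟩)) =
      MulAut.conjNormal (φ₀ σ) (f.1 ⟨ι (MulAut.conjNormal σ⁻¹ y).1, _⟩)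
    rw [← hact]
    refine congrArg (fun a => MulAut.conjNormal (φ (ι σ)) (f.1 a)) (Subtype.ext ?_)
    simp [map_mul, map_inv, mul_assoc]

end FixedLevel

/-! ### 1b. Fixed level: Kummer classes are carried to Kummer classes -/

section FixedLevelKummer

variable {G₀ G G' : Type*} [Group G₀] [TopologicalSpace G₀] [SeparatelyContinuousMul G₀]
  [Group G] [TopologicalSpace G] [SeparatelyContinuousMul G]
  [Group G'] [TopologicalSpace G'] [IsTopologicalGroup G']
  {φ : G →* G'} {A' : Subgroup G'} [A'.Normal] [IsMulCommutative A']
  {A : Type*} [CommGroup A] [MulDistribMulAction G A] [MulDistribMulAction G₀ A] [TopologicalSpace A]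

/-- **Naturality of continuous Kummer classes under the action-level pull-back**: for `ι : Π₀ → Π`, `Π₀` acting on the
module `A` through `ι` (`hsmul`), coefficient data `c` over `φ` and `c₀` over `φ₀` with the same underlying homomorphism,
the pull-back of the Kummer class of an `H`-invariant `a` is the Kummer class of `a` over `H₀`.
[cite: NeukirchSchmidtWingberg2008, I §5] -/
theorem comapAct_kummerContClass (ι : G₀ →* G) (hι : Continuous ι) (φ₀ : G₀ →* G')
    (hact : ∀ (g : G₀) (a : A'), MulAut.conjNormal (φ (ι g)) a = MulAut.conjNormal (φ₀ g) a)
    (hsmul : ∀ (g : G₀) (a : A), g • a = ι g • a)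
    (c : CyclotomeCoefficients φ A' A) (c₀ : CyclotomeCoefficients φ₀ A' A)
    (hc : ∀ ζ, c₀.hom ζ = c.hom ζ) {H₀ : Subgroup G₀} {H : Subgroup G} (hle : H₀.map ι ≤ H)
    {a : A} (x : RootSystem a) (ha : a ∈ MulAction.fixedPoints H A)
    (hx : ∀ n : ℕ+, IsOpen (MulAction.stabilizer G (x.root n) : Set G))
    (ha₀ : a ∈ MulAction.fixedPoints H₀ A)
    (hx₀ : ∀ n : ℕ+, IsOpen (MulAction.stabilizer G₀ (x.root n) : Set G₀)) :
    contH1ComapAct φ A' ι hι φ₀ hact hle (c.kummerContClass H x ha hx) = c₀.kummerContClass H₀ x ha₀ hx₀ := by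
  rw [CyclotomeCoefficients.kummerContClass, CyclotomeCoefficients.kummerContClass, contH1ComapAct_mk]
  refine ContH1.mk_congr _ (funext fun y => ?_) _ _
  rw [hc]
  congr 1
  refine Subtype.ext (funext fun n => ?_)
  rw [RootSystem.kummerCocycle_apply, RootSystem.kummerCocycle_apply, Subgroup.smul_def, Subgroup.smul_def, hsmul]

end FixedLevelKummer

/-! ### 2. Limits: `lim_K H¹_φ(H ⊓ K, A) → lim_{K₀} H¹_{φ₀}(H₀ ⊓ K₀, A)` -/

section Limit

universe u

variable {P₀ P : TopGroup.{u}} {G' : Type u} [Group G'] [TopologicalSpace G'] [IsTopologicalGroup G']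
  (φ : P →* G') (A : Subgroup G') [A.Normal] [IsMulCommutative A]
  (ι : P₀ →* P) (hι : Continuous ι) (φ₀ : P₀ →* G')
  (hact : ∀ (g : P₀) (a : A), MulAut.conjNormal (φ (ι g)) a = MulAut.conjNormal (φ₀ g) a)
  {H₀ : Subgroup P₀} {H : Subgroup P} (hH : H₀.map ι ≤ H)

/-- Member-wise pull-back `H¹_φ(H ⊓ K, A) → H¹_{φ₀}(H₀ ⊓ ι⁻¹K, A)` between the two systems.
[cite: NeukirchSchmidtWingberg2008, I §5] -/
def gmodComapAct (i : Idx (P := P) ⊥) : Gmod φ A H ⊥ i →+ Gmod φ₀ A H₀ ⊥ (Idx.comap ι hι i) :=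
  MonoidHom.toAdditive (contH1ComapAct φ A ι hι φ₀ hact (inf_comap_map_le ι hι hH i))

/-- The member-wise pull-backs commute with the transition maps. [cite: NeukirchSchmidtWingberg2008, I §5] -/
theorem gmodComapAct_fmod {i j : Idx (P := P) ⊥} (hij : i ≤ j) (x : Gmod φ A H ⊥ i) :
    gmodComapAct φ A ι hι φ₀ hact hH j (fmod φ A H ⊥ i j hij x) =
      fmod φ₀ A H₀ ⊥ (Idx.comap ι hι i) (Idx.comap ι hι j) (Idx.comap_mono ι hι hij)
        (gmodComapAct φ A ι hι φ₀ hact hH i x) :=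
  congrArg Additive.ofMul
    (contH1Res_comapAct φ A ι hι φ₀ hact (inf_comap_map_le ι hι hH i) (inf_comap_map_le ι hι hH j)
      (inf_le_inf_left H₀ (Idx.le_iff.mp (Idx.comap_mono ι hι hij))) (inf_le_inf_left H (Idx.le_iff.mp hij))
      (Additive.toMul x)).symm

/-- **Pull-back of the limits INTO the `φ₀`-system**: `lim_K H¹_φ(H ⊓ K, A) → lim_{K₀} H¹_{φ₀}(H₀ ⊓ K₀, A)` along
`ι : Π₀ → Π` with `ι(H₀) ≤ H` and `φ ∘ ι`, `φ₀` inducing the same action on `A` (DEFINED by the universal property).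
For `ι = s_t` the evaluation section of label `t` and `φ₀` the common `G_v`-action on the cyclotome, this IS print's
restriction into the copy `Ψ_cns(M^Θ_*)_t` followed by the identification of the copies.
[cite: Mochizuki2012, Cor 3.5 (ii) p.95] -/
def h1LimComapAct : h1Lim φ A H ⊥ →+ h1Lim φ₀ A H₀ ⊥ :=
  AddCommGroup.DirectLimit.lift (Gmod φ A H ⊥) (fmod φ A H ⊥) (h1Lim φ₀ A H₀ ⊥)
    (fun i => (h1Of φ₀ A H₀ ⊥ (Idx.comap ι hι i)).comp (gmodComapAct φ A ι hι φ₀ hact hH i))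
    (fun i j hij x => by
      change h1Of φ₀ A H₀ ⊥ (Idx.comap ι hι j) (gmodComapAct φ A ι hι φ₀ hact hH j (fmod φ A H ⊥ i j hij x)) =
        h1Of φ₀ A H₀ ⊥ (Idx.comap ι hι i) (gmodComapAct φ A ι hι φ₀ hact hH i x)
      rw [gmodComapAct_fmod, h1Of_fmod])

/-- `h1LimComapAct` on generators. [cite: NeukirchSchmidtWingberg2008, I §5] -/
@[simp] theorem h1LimComapAct_of (i : Idx (P := P) ⊥) (x : Gmod φ A H ⊥ i) :
    h1LimComapAct φ A ι hι φ₀ hact hH (h1Of φ A H ⊥ i x) =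
      h1Of φ₀ A H₀ ⊥ (Idx.comap ι hι i) (gmodComapAct φ A ι hι φ₀ hact hH i x) :=
  AddCommGroup.DirectLimit.lift_of (G := Gmod φ A H ⊥) (f := fmod φ A H ⊥) _ _ _ i x

/-- **The pull-back intertwines the conjugation actions on the limits** (`H₀ ⊴ Π₀`, `H ⊴ Π`): for `σ ∈ Π₀`,
`ι^*(conj_{ι σ} y) = conj_σ (ι^* y)` — the equivariance «`r_t (conj (s_t g) x) = conj g (r_t x)`» of [IUTchII] Cor 3.5 (ii)
for restriction to the decomposition group of label `t`, now valued in the COMMON `φ₀`-system.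
[cite: Mochizuki2012, Cor 3.5 (ii) p.95] -/
theorem h1LimComapAct_conj [H₀.Normal] [H.Normal] (σ : P₀) (y : h1Lim φ A H ⊥) :
    h1LimComapAct φ A ι hι φ₀ hact hH (h1LimConj φ A H (ι σ) y) =
      h1LimConj φ₀ A H₀ σ (h1LimComapAct φ A ι hι φ₀ hact hH y) := by
  have key : (h1LimComapAct φ A ι hι φ₀ hact hH).comp (h1LimConj φ A H (ι σ)) =
      (h1LimConj φ₀ A H₀ σ).comp (h1LimComapAct φ A ι hι φ₀ hact hH) := by
    refine h1Lim_hom_ext φ A H fun i x => ?_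
    haveI : (H₀ ⊓ (Idx.comap ι hι i.core).K).Normal := inf_comap_normal ι hι i.core
    change h1LimComapAct φ A ι hι φ₀ hact hH (h1LimConj φ A H (ι σ) (h1Of φ A H ⊥ i x)) =
      h1LimConj φ₀ A H₀ σ (h1LimComapAct φ A ι hι φ₀ hact hH (h1Of φ A H ⊥ i x))
    rw [← h1Of_fmod φ A H ⊥ i.le_core x, h1LimConj_of_normal φ A H (ι σ) i.core, h1LimComapAct_of,
      h1LimComapAct_of, h1LimConj_of_normal φ₀ A H₀ σ (Idx.comap ι hι i.core)]
    exact congrArg (h1Of φ₀ A H₀ ⊥ (Idx.comap ι hι i.core))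
      (congrArg Additive.ofMul
        (contH1ComapAct_conj φ A ι hι φ₀ hact (inf_comap_map_le ι hι hH i.core) σ
          (Additive.toMul (fmod φ A H ⊥ i i.core i.le_core x))))
  exact DFunLike.congr_fun key y

end Limit

/-! ### 3. Limits: naturality of the limit Kummer map -/

section Kummer

variable {P₀ P : TopGroup.{0}} {G' : Type} [Group G'] [TopologicalSpace G'] [IsTopologicalGroup G']
  (φ : P →* G') (A' : Subgroup G') [A'.Normal] [IsMulCommutative A'] (H : Subgroup P)
  {A : Type} [CommGroup A] [MulDistribMulAction P A] [MulDistribMulAction P₀ A] [TopologicalSpace A]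
  [RootableBy A ℕ]
  (c : CyclotomeCoefficients φ A' A)
  (hA : ∀ b : A, IsOpen (MulAction.stabilizer P b : Set P))
  (hfi : ∀ b : A, (MulAction.stabilizer P b).FiniteIndex)
  (ι : P₀ →* P) (hι : Continuous ι) (φ₀ : P₀ →* G')
  (hact : ∀ (g : P₀) (a : A'), MulAut.conjNormal (φ (ι g)) a = MulAut.conjNormal (φ₀ g) a)
  {H₀ : Subgroup P₀}

/-- **`ι^*(κ_Π b) = κ_{Π₀} b` for the action-level pull-back**: `h1LimComapAct` carries abc-iut-w4-d007's limit Kummer class of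
`b` (coefficients `c` over `φ`) to the limit Kummer class of `b` over `Π₀` for ANY coefficient datum `c₀` over `φ₀` with the same
underlying `Λ(A) → A'`, the action of `Π₀` on the module `A` being through `ι` (`hsmul`).
[cite: NeukirchSchmidtWingberg2008, I §5] -/
theorem h1LimComapAct_h1LimKummer (hH : H₀.map ι ≤ H) (hsmul : ∀ (g : P₀) (a : A), g • a = ι g • a)
    (c₀ : CyclotomeCoefficients φ₀ A' A) (hc : ∀ ζ, c₀.hom ζ = c.hom ζ)
    (hA₀ : ∀ b : A, IsOpen (MulAction.stabilizer P₀ b : Set P₀))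
    (hfi₀ : ∀ b : A, (MulAction.stabilizer P₀ b).FiniteIndex) (b : A) :
    h1LimComapAct φ A' ι hι φ₀ hact hH (Multiplicative.toAdd (h1LimKummer φ A' H c hA hfi b)) =
      Multiplicative.toAdd (h1LimKummer φ₀ A' H₀ c₀ hA₀ hfi₀ b) := by
  have hb := mem_fixedPoints_stabIdx H hA hfi b
  have hb₀ := mem_fixedPoints_inf_comap H ι hι hH hsmul (stabIdx hA hfi b) hb
  rw [h1LimKummer_eq_h1Of_kummerContClass φ A' H c hA hfi b (stabIdx hA hfi b) hb (RootSystem.ofRootableBy b),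
    h1LimKummer_eq_h1Of_kummerContClass φ₀ A' H₀ c₀ hA₀ hfi₀ b (Idx.comap ι hι (stabIdx hA hfi b)) hb₀
      (RootSystem.ofRootableBy b),
    toAdd_ofAdd, toAdd_ofAdd, h1LimComapAct_of]
  refine congrArg (h1Of φ₀ A' H₀ ⊥ (Idx.comap ι hι (stabIdx hA hfi b))) ?_
  change Additive.ofMul (contH1ComapAct φ A' ι hι φ₀ hact (inf_comap_map_le ι hι hH (stabIdx hA hfi b))
      (c.kummerContClass (H ⊓ (stabIdx hA hfi b).K) (RootSystem.ofRootableBy b) hb fun _ => hA _)) = _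
  rw [comapAct_kummerContClass ι hι φ₀ hact hsmul c c₀ hc (inf_comap_map_le ι hι hH (stabIdx hA hfi b))
    (RootSystem.ofRootableBy b) hb (fun _ => hA _) hb₀ (fun _ => hA₀ _)]

/-- The same for the Kummer map restricted to a submonoid `O ≤ A` (`h1LimKummerOn`, «`Ψ_cns := M_TM`»): the copy of the
constants at label `t`, read in the common `φ₀`-system, IS the `φ₀`-Kummer image — print's identification of the labelled
copies `Ψ_cns(M^Θ_*)_t`. [cite: Mochizuki2012, Prop 3.1 (ii) p.88] -/
theorem h1LimComapAct_h1LimKummerOn (hH : H₀.map ι ≤ H) (hsmul : ∀ (g : P₀) (a : A), g • a = ι g • a)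
    (c₀ : CyclotomeCoefficients φ₀ A' A) (hc : ∀ ζ, c₀.hom ζ = c.hom ζ)
    (hA₀ : ∀ b : A, IsOpen (MulAction.stabilizer P₀ b : Set P₀))
    (hfi₀ : ∀ b : A, (MulAction.stabilizer P₀ b).FiniteIndex) (O : Submonoid A) (m : O) :
    h1LimComapAct φ A' ι hι φ₀ hact hH (Multiplicative.toAdd (h1LimKummerOn φ A' H c hA hfi O m)) =
      Multiplicative.toAdd (h1LimKummerOn φ₀ A' H₀ c₀ hA₀ hfi₀ O m) := by
  rw [h1LimKummerOn_apply, h1LimKummerOn_apply]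
  exact h1LimComapAct_h1LimKummer φ A' H c hA hfi ι hι φ₀ hact hH hsmul c₀ hc hA₀ hfi₀ m

end Kummer

end Literature.IUT.HodgeArakelov

end
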